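import Literature.AlgebraicTopology.Homotopy.FibreBundlesEulerWHE
import Literature.AlgebraicTopology.SingularHomology.FiltrationLefschetzCupGeneration
import Literature.AlgebraicTopology.SingularHomology.ExhaustionCupGeneration
import Literature.AlgebraicTopology.SingularHomology.CohomologyFiniteness
import HarnessLib

/-!
# `H⁴(E) = η ⌣ H²(E) + Σ_i ζ_i ⌣ H²(E)` for a fibre bundle over a base exhausted by sublevel sets
# homotopy equivalent to finite `2`-complexes, from cap-detection on the pull-backs

Topic `Literature/AlgebraicTopology/Homotopy`. Assembly of the topological half of the proof of
D. Arapura, *Hodge cycles and the Leray filtration*, Pacific J. Math. 319 (2022), Cor. 1.5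
(p. 5) — "`H²(U, R²f_*ℚ) ≅ ⊕_i H²(U, ℚ) ∪ [𝒵_i]`", with hard Lefschetz `R¹ ≅ R³` (proof of
Thm. 1.2) and `R⁴ = ℚ h²`, i.e. **`H⁴(V) = h ∪ H²(V) + Σ_i H²(V) ∪ [𝒵_i]`** for the smooth
`p_g = 0` surface family `V → U` over an affine surface — in the tree's Leray-free form: the base
`U(ℂ)` is exhausted by compact sublevel sets of a proper Morse function, each homotopy
equivalent to a finite `2`-complex (Andreotti–Frankel, `AndreottiFrankelHomotopyType.lean`); over
a finite `2`-complex the statement is the three-stage descent on the skeletal filtration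
(`SingularHomology/FiltrationLefschetzCupGeneration.lean`, fed by fibrewise hard Lefschetz and
fibrewise spanning through `SerreSkeletalCapDetection.lean` and the `E¹` hard Lefschetz of the
tree's Deligne-degeneration programme); and the passage to the whole space is the Milnor sequence
with Mittag-Leffler (`SingularHomology/ExhaustionCupGeneration.lean`). This file performs the
middle plumbing once and for all:

* `exists_eq_cupProduct_add_sum_of_pullback_detect` — for a fibre bundle `π : E → B` with fibre
  of finite-dimensional bounded homology, `f : B → ℝ` continuous with cofinal levels `a` such
  that `{f ≤ a}` is homotopy equivalent to a finite Hausdorff CW complex without cells of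
  dimension `> 2`, and finitely many classes `η, ζ_i ∈ H²(E; K)`: IF on every fibre bundle
  `P → C` with fibre `F` over such a complex mapping fibrewise into `π` (fibres mapped
  homeomorphically) the pulled-back classes jointly cap-detect `H₄(P; K)` (hypothesis `hP`, the
  output shape of `Filtration.eq_zero_of_capProduct_eq_zero_of_eHardLefschetz_of_eq_univ`), THEN
  every `c ∈ H⁴(E; K)` is `η ⌣ w + Σ_i ζ_i ⌣ u_i`;
* `exists_seq_of_forall_exists_gt` (good levels `aₙ ↑ ∞`),
  `exists_homeomorph_fibre_pullback_restrictPreimage` (fibres of the pull-back of a restriction).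

Ingredients (all in the tree): restriction and pull-back of bundles (`IsFibreBundleWith.restrictPreimage`,
`.pullback`), the weak equivalence `pull-back → π⁻¹Bₙ` (`isWeakHomotopyEquiv_pullback_snd`,
Spanier 7.6.25 for the homology isomorphisms), finiteness of `H_•` of bundles over (bases
homotopy equivalent to) finite complexes (`relEuler_eq_sum_card_cell_mul`,
`relEuler_eq_mul_of_homotopyEquiv`, Spanier 9.3.1) and of `H^•` (`CohomologyFiniteness`), the
duality "cap-detection ⇒ cup-generation" (`exists_eq_sum_cupProduct_of_capDetect_of_map`) and the
exhaustion theorem (`exists_eq_sum_cupProduct_of_exhaustion`). Everything is proved; no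
definition and no named fact is introduced (D-0026). Brick of
`Literature.AlgebraicGeometry.HodgeTheory.Arapura2022_thm_1_2_smoothPart_pgZeroSurfaceFibration`
(hypothesis `hI` of `…_of_map_mem_span_cupProduct`).

## References

* D. Arapura, *Hodge cycles and the Leray filtration*, Pacific J. Math. 319 (2022) 233–258,
  proof of Thm. 1.2 (p. 4) and proof of Cor. 1.5 (p. 5). [Arapura2022]
* E. H. Spanier, *Algebraic Topology*, Springer (1981), Ch. 7, Sec. 6, Thm. 25; Ch. 9, Sec. 3,
  Thm. 1. [Spanier1981]
* A. Hatcher, *Algebraic Topology*, CUP (2002), §3.F Thm. 3F.8, §3.1 Thm. 3.2, §3.3 p. 241.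
  [HatcherAT2002]
-/


noncomputable section

open Set Function CategoryTheory Topology
open Literature.AlgebraicTopology.SingularHomology

namespace Literature.AlgebraicTopology.Homotopy

universe u w

/-! ### A strictly increasing unbounded sequence of good levels -/

/-- If beyond every real level there is a "good" level, there is a strictly increasing sequence of
good levels `aₙ > n` with `aₙ + 1 < aₙ₊₁`. [folklore] -/
theorem exists_seq_of_forall_exists_gt {P : ℝ → Prop} (h : ∀ b : ℝ, ∃ a, b < a ∧ P a) :
    ∃ a : ℕ → ℝ, (∀ n, P (a n)) ∧ (∀ n : ℕ, (n : ℝ) < a n) ∧ ∀ n, a n + 1 < a (n + 1) := by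
  choose next hnext hP using h
  let a : ℕ → ℝ := fun n => Nat.rec (next 0) (fun _ x => next (x + 1)) n
  have ha0 : a 0 = next 0 := rfl
  have hasucc : ∀ n, a (n + 1) = next (a n + 1) := fun n => rfl
  refine ⟨a, fun n => ?_, fun n => ?_, fun n => ?_⟩
  · cases n with
    | zero => rw [ha0]; exact hP 0
    | succ n => rw [hasucc]; exact hP _
  · induction n with
    | zero => rw [ha0, Nat.cast_zero]; exact hnext 0
    | succ n ih =>
      rw [hasucc, Nat.cast_succ]
      have := hnext (a n + 1)
      linarith
  · rw [hasucc]; exact hnext _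

/-! ### The fibres of the pull-back of a restriction -/

section PullbackFibre

variable {E : Type u} {B : Type u} [TopologicalSpace E] [TopologicalSpace B] (π : E → B)
  (S : Set B) {C : Type u} [TopologicalSpace C] (g : C(C, ↥S))

/-- The fibre over `c` of the pull-back of `π|_{π⁻¹S} : π⁻¹S → S` along `g : C → S` is
homeomorphic, compatibly with the maps to `E`, to the fibre `π⁻¹(g c)`. [folklore] -/
theorem exists_homeomorph_fibre_pullback_restrictPreimage (c : C) :
    ∃ h : ↥((Function.Pullback.fst : (⇑g).Pullback (S.restrictPreimage π) → C) ⁻¹' {c}) ≃ₜ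
        ↥(π ⁻¹' {((g c : ↥S) : B)}),
      ∀ x, (h x : E) = ((Function.Pullback.snd x.1 : ↥(π ⁻¹' S)) : E) := by
  -- membership bookkeeping
  have hfwd : ∀ x : ↥((Function.Pullback.fst : (⇑g).Pullback (S.restrictPreimage π) → C) ⁻¹' {c}),
      ((Function.Pullback.snd x.1 : ↥(π ⁻¹' S)) : E) ∈ π ⁻¹' {((g c : ↥S) : B)} := fun x => by
    have h1 : S.restrictPreimage π (Function.Pullback.snd x.1) = g (Function.Pullback.fst x.1) :=
      x.1.2.symm
    have h2 : Function.Pullback.fst x.1 = c := x.2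
    have h3 : π ((Function.Pullback.snd x.1 : ↥(π ⁻¹' S)) : E) =
        ((g (Function.Pullback.fst x.1) : ↥S) : B) := congrArg Subtype.val h1
    rw [h2] at h3
    exact h3
  have hbS : ∀ e : ↥(π ⁻¹' {((g c : ↥S) : B)}), (e : E) ∈ π ⁻¹' S := fun e => by
    have he : π e = ((g c : ↥S) : B) := e.2
    show π e ∈ S
    rw [he]; exact (g c).2
  have hbw : ∀ e : ↥(π ⁻¹' {((g c : ↥S) : B)}),
      g c = S.restrictPreimage π ⟨(e : E), hbS e⟩ := fun e =>
    Subtype.ext (show ((g c : ↥S) : B) = π e from (e.2 : π e = _).symm)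
  refine ⟨{ toFun := fun x => ⟨_, hfwd x⟩
            invFun := fun e => ⟨⟨(c, ⟨(e : E), hbS e⟩), hbw e⟩, rfl⟩
            left_inv := fun x => ?_
            right_inv := fun e => rfl
            continuous_toFun := ?_
            continuous_invFun := ?_ }, fun x => rfl⟩
  · -- `x = ((c, snd x), _)` since `fst x = c`
    obtain ⟨⟨⟨c', z⟩, hz⟩, hx⟩ := x
    have hc' : c' = c := hx
    subst hc'
    rfl
  · exact ((continuous_subtype_val.comp (continuous_snd.comp continuous_subtype_val)).comp
      continuous_subtype_val).subtype_mk _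
  · refine Continuous.subtype_mk (Continuous.subtype_mk (Continuous.prodMk continuous_const
      ((continuous_subtype_val).subtype_mk _)) _) _

end PullbackFibre


/-! ### The generation theorem -/

section Main

variable (K : Type w) [Field K] {E : Type u} {B : Type u} {F : Type u} [TopologicalSpace E]
  [TopologicalSpace B] [TopologicalSpace F] {π : E → B}

/-- **`H⁴(E; K) = η ⌣ H²(E; K) + Σ_i ζ_i ⌣ H²(E; K)` for a fibre bundle over a base exhausted by
sublevel sets homotopy equivalent to finite `2`-complexes, from cap-detection on the pull-backs
to finite `2`-complexes.** Let `π : E → B` be a fibre bundle whose fibre `F` has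
finite-dimensional bounded homology, `f : B → ℝ` continuous such that beyond every level there
is a level `a` with `{f ≤ a}` homotopy equivalent to a finite Hausdorff CW complex without cells
of dimension `> 2` (the output of Andreotti–Frankel on a smooth affine surface,
`AndreottiFrankelHomotopyType.lean`), and `η, ζ_i ∈ H²(E; K)` finitely many classes. Suppose
(`hP`) that for every finite Hausdorff CW complex `C` without cells of dimension `> 2` and every
fibre bundle `p : P → C` with fibre `F` mapping fibrewise to `π` (a map `φ : P → E` over some
`g : C → B` inducing homeomorphisms of the fibres), the classes `φ^*η`, `φ^*ζ_i` jointly detect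
`H₄(P; K)` under the cap product — the statement produced on the skeletal filtration of `P` by
the three-stage descent `Filtration.eq_zero_of_capProduct_eq_zero_of_eHardLefschetz_of_eq_univ`
from fibrewise hard Lefschetz and fibrewise spanning. Then every `c ∈ H⁴(E; K)` is
`η ⌣ w + Σ_i ζ_i ⌣ u_i`. Proof: choose good levels `aₙ ↑ ∞`; over `Bₙ = {f ≤ aₙ}` pull the
restricted bundle back to the CW model `Cₙ ≃ Bₙ`; the pull-back maps to `Eₙ = π⁻¹Bₙ` by a weak
homotopy equivalence (`isWeakHomotopyEquiv_pullback_snd`), so cap-detection on it gives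
cup-generation on `Eₙ` (`exists_eq_sum_cupProduct_of_capDetect_of_map`: duality, `H₄` of the
pull-back being finite-dimensional, Spanier 9.3.1); the `H^q(Eₙ; K)` are finite-dimensional
(bundle over a base homotopy equivalent to a finite complex), so the generation passes to
`E = ⋃ π⁻¹{f < aₙ}` by the Milnor sequence and Mittag-Leffler
(`exists_eq_sum_cupProduct_of_exhaustion`). This is the topological skeleton of the proof of
D. Arapura, *Hodge cycles and the Leray filtration* (2022), Cor. 1.5 (`H⁴(V) = h ∪ H²(V) +
Σ_i H²(V) ∪ [𝒵_i]` for a `p_g = 0` surface family over an affine surface), with the Leray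
spectral sequence replaced by the skeletal filtrations of the compact pieces.
[cite: Arapura2022, proof of Cor. 1.5 (p. 5) and proof of Thm. 1.2 (first reflection)]
[cite: Spanier1981, Ch. 9, Sec. 3, Thm. 1; Ch. 7, Sec. 6, Thm. 25] [cite: HatcherAT2002, §3.F Thm. 3F.8] -/
theorem exists_eq_cupProduct_add_sum_of_pullback_detect (hπ : IsFibreBundleWith F π) {N : ℕ}
    (hF : FinRelHomology K K F ∅ N) {f : B → ℝ} (hf : Continuous f)
    (hCW : ∀ b : ℝ, ∃ a : ℝ, b < a ∧ ∃ (C : Type u) (_ : TopologicalSpace C) (_ : T2Space C)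
        (_ : CWComplex (univ : Set C)), RelCWComplex.Finite (univ : Set C) ∧
        (∀ m, 2 < m → IsEmpty (RelCWComplex.cell (univ : Set C) m)) ∧
        Nonempty (ContinuousMap.HomotopyEquiv ↥(f ⁻¹' Iic a) C))
    (η : singularCohomology K K E 2) {ι : Type} [Fintype ι] (ζ : ι → singularCohomology K K E 2)
    (hP : ∀ (C : Type u) [TopologicalSpace C] [T2Space C] [CWComplex (univ : Set C)],
        RelCWComplex.Finite (univ : Set C) →
        (∀ m, 2 < m → IsEmpty (RelCWComplex.cell (univ : Set C) m)) →
        ∀ (P : Type u) [TopologicalSpace P] (p : P → C), IsFibreBundleWith F p →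
        ∀ (g : C(C, B)) (φ : C(P, E)), (∀ x, π (φ x) = g (p x)) →
        (∀ c, ∃ h : ↥(p ⁻¹' {c}) ≃ₜ ↥(π ⁻¹' {g c}), ∀ x, (h x : E) = φ x) →
        ∀ x : singularHomology K K P 4,
          capProduct (show 2 + 2 = 4 by rfl) (singularCohomology.map K K φ 2 η) x = 0 →
          (∀ i, capProduct (show 2 + 2 = 4 by rfl) (singularCohomology.map K K φ 2 (ζ i)) x = 0) →
          x = 0)
    (c : singularCohomology K K E 4) :
    ∃ (w : singularCohomology K K E 2) (u : ι → singularCohomology K K E 2),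
      c = cupProduct (show 2 + 2 = 4 by rfl) η w + ∑ i, cupProduct (show 2 + 2 = 4 by rfl) (ζ i) (u i) := by
  classical
  -- good levels `aₙ ↑ ∞`
  obtain ⟨a, haCW, han, hasucc⟩ := exists_seq_of_forall_exists_gt hCW
  have hamono : StrictMono a := strictMono_nat_of_lt_succ fun n => by linarith [hasucc n]
  -- the exhaustion `Oₙ = π⁻¹{f < aₙ}`, `Cₙ = π⁻¹{f ≤ aₙ}`
  set O : ℕ → Set E := fun n => π ⁻¹' (f ⁻¹' Iio (a n)) with hO
  set Cn : ℕ → Set E := fun n => π ⁻¹' (f ⁻¹' Iic (a n)) with hCn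
  have hOo : ∀ n, IsOpen (O n) := fun n => (isOpen_Iio.preimage hf).preimage hπ.continuous
  have hOmono : Monotone O := fun m n hmn e (he : f (π e) < a m) =>
    lt_of_lt_of_le he (hamono.monotone hmn)
  have hOuniv : ⋃ n, O n = univ := by
    refine eq_univ_of_forall fun e => mem_iUnion.2 ?_
    obtain ⟨n, hn⟩ := exists_nat_gt (f (π e))
    exact ⟨n, show f (π e) < a n from hn.trans (han n)⟩
  have hOC : ∀ n, O n ⊆ Cn n := fun n e (he : f (π e) < a n) => (le_of_lt he : f (π e) ≤ a n)
  have hCO : ∀ n, Cn n ⊆ O (n + 1) := fun n e (he : f (π e) ≤ a n) =>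
    show f (π e) < a (n + 1) by linarith [hasucc n]
  -- the family of classes `(η, ζ_i)`
  let gE : Option ι → singularCohomology K K E 2 := fun j => j.elim η ζ
  -- over each `Bₙ = {f ≤ aₙ}`: the restricted bundle, its CW model, finiteness and generation
  have hlevel : ∀ n, (∀ q, Module.Finite K (singularCohomology K K ↥(Cn n) q)) ∧
      ∀ y : singularCohomology K K ↥(Cn n) 4, ∃ v : Option ι → singularCohomology K K ↥(Cn n) 2,
        y = ∑ j, cupProduct (show 2 + 2 = 4 by rfl)
          (singularCohomology.map K K (subsetIncl (Cn n)) 2 (gE j)) (v j) := by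
    intro n
    obtain ⟨C, _, _, _, hfin, hdim, ⟨e⟩⟩ := haCW n
    haveI := hfin
    -- the restricted bundle `πₙ : π⁻¹Bₙ → Bₙ` and its pull-back to `C`
    set Bn : Set B := f ⁻¹' Iic (a n) with hBn
    have hπn : IsFibreBundleWith F (Bn.restrictPreimage π) := hπ.restrictPreimage Bn
    let eInv : C(C, ↥Bn) := e.symm.toFun
    have heInv : IsWeakHomotopyEquiv eInv := isWeakHomotopyEquiv_homotopyEquiv e.symm
    let P : Type u := (⇑eInv).Pullback (Bn.restrictPreimage π)
    have hPb : IsFibreBundleWith F (Function.Pullback.fst : P → C) := hπn.pullback eInv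
    let ψ : C(P, ↥(Cn n)) := ⟨Function.Pullback.snd, continuous_snd.comp continuous_subtype_val⟩
    have hψ : IsWeakHomotopyEquiv ψ := hπn.isWeakHomotopyEquiv_pullback_snd eInv heInv
    -- finiteness: `H_•(P)` (bundle over the finite complex) and `H_•(π⁻¹Bₙ)`, `H^•(π⁻¹Bₙ)`
    obtain ⟨d, -, hfinP, -⟩ := hPb.relEuler_eq_sum_card_cell_mul K hF
    obtain ⟨⟨N', hfinCn⟩, -, -⟩ := hπn.relEuler_eq_mul_of_homotopyEquiv e.symm K hF
    have hfinH : ∀ q, Module.Finite K (singularHomology K K ↥(Cn n) q) := fun q =>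
      hfinCn.finite_singularHomology q
    have hfinCoh : ∀ q, Module.Finite K (singularCohomology K K ↥(Cn n) q) := fun q => by
      haveI := hfinH q
      exact finite_singularCohomology_of_finite_singularHomology q fun m _ => hfinH m
    refine ⟨hfinCoh, fun y => ?_⟩
    -- cap-detection on `P` (hypothesis `hP` with `φ = val ∘ ψ`, `g = val ∘ eInv`)
    haveI : FiniteDimensional K (singularHomology K K P 4) := hfinP.finite_singularHomology 4
    let φ : C(P, E) := (subsetIncl (Cn n)).comp ψ
    let g : C(C, B) := (⟨Subtype.val, continuous_subtype_val⟩ : C(↥Bn, B)).comp eInv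
    have hφ : ∀ x : P, π (φ x) = g (Function.Pullback.fst x) := fun x =>
      congrArg Subtype.val x.2.symm
    have hfib : ∀ c, ∃ h : ↥((Function.Pullback.fst : P → C) ⁻¹' {c}) ≃ₜ ↥(π ⁻¹' {g c}),
        ∀ x, (h x : E) = φ x := fun c =>
      exists_homeomorph_fibre_pullback_restrictPreimage π Bn eInv c
    have hdetP := hP C hfin hdim P Function.Pullback.fst hPb g φ hφ hfib
    -- transfer to `π⁻¹Bₙ` along the weak equivalence `ψ` and dualise
    have hbij : ∀ q, Function.Bijective (singularHomology.map K K ψ q).hom := fun q => by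
      haveI := isIso_singularHomology_map_of_isWeakHomotopyEquiv K ψ hψ q
      exact (asIso (singularHomology.map K K ψ q)).toLinearEquiv.bijective
    have hmapφ : ∀ j, singularCohomology.map K K ψ 2
        (singularCohomology.map K K (subsetIncl (Cn n)) 2 (gE j)) =
          singularCohomology.map K K φ 2 (gE j) := fun j => by
      rw [← ModuleCat.comp_apply, ← singularCohomology.map_comp]
    exact exists_eq_sum_cupProduct_of_capDetect_of_map K ψ (J := Option ι) (d := fun _ => 2)
      (e := fun _ => 2) (fun _ => (show 2 + 2 = 4 by rfl))
      (fun j => singularCohomology.map K K (subsetIncl (Cn n)) 2 (gE j))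
      (fun x hx => hdetP x (by have h := hx none; rw [hmapφ] at h; exact h) fun i => by
        have h := hx (some i); rw [hmapφ] at h; exact h)
      (hbij 4).2 (fun _ => (hbij 2).1) y
  -- Milnor + Mittag-Leffler over the exhaustion
  obtain ⟨w, hw⟩ := exists_eq_sum_cupProduct_of_exhaustion K hOo hOmono hOuniv hOC hCO
    (J := Option ι) (k := 3) (d := fun _ => 2) (e := fun _ => 2) (fun _ => (show 2 + 2 = 3 + 1 by rfl))
    gE (fun n _ => (hlevel n).1 2) (fun n => (hlevel n).1 3) (fun n y => (hlevel n).2 y) c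
  refine ⟨w none, fun i => w (some i), ?_⟩
  rw [hw, Fintype.sum_option]
  rfl

end Main

end Literature.AlgebraicTopology.Homotopy

end
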